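import Summits.CriticalPhenomena.CardyFormulaZ2.Theses.CardySelfRefinement
import Summits.CriticalPhenomena.CardyFormulaZ2.Theorems.CardySelfRefinementLagHandOffLimitMarkov
import Summits.CriticalPhenomena.CardyFormulaZ2.Theorems.CardySelfRefinementLagHandOffSlitHandOffDyadicApprox
import HarnessLib

/-!
# The slit hand-off reduced to dyadic polygons: partial helper for stub `stub_slitHandOff` (R2″)
# of line `hitting-tournament` for crux `LagHandOff` (stmt-CriticalPhenomena-10268)

The registered stub `stub_slitHandOff` (= hypothesis `H` of the landed reduction
`stub_limitMarkov_of_core`, `…LagHandOffLimitMarkov.lean`) asks, for every chordal family `P`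
pinned by a subsequential quad-crossing limit: ONE slit kernel `K (U; x, b)` (probability laws,
Borel along pasts) such that for every Dobrushin domain `D` and EVERY closed `F ⊆ ℂ` there is an
antitone sequence of closed sets `G k ↓ F` with (markov) `P D` disintegrated at the first hitting
of every `G k` through `K (remainingDomain D ·; tip, b)` and (left-continuity) `K` a.s. weakly
left-continuous along the pasts `γ.stopAt (G k) → γ.stopAt F`.

This file lands the reduction `stub_slitHandOff_of_dyadic : H_𝒟 → H` to the COUNTABLE class `𝒟`
of **dyadic polygons** (finite unions of closed dyadic squares
`[i 2⁻ⁿ, (i+1) 2⁻ⁿ] × [j 2⁻ⁿ, (j+1) 2⁻ⁿ]` of one level), discharging the choice of the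
approximating stopping sets and the passage from bounded to arbitrary closed `F`:

* `H_𝒟` = for pinned `P` (and discretisability): `∃ K`, probability-valued ∧ Borel along pasts ∧
  (**slit identification on `𝒟`**) `P D` is disintegrated through `K` at the first hitting of
  every dyadic polygon, for every `D` ∧ (**left-continuity along `𝒟`**) for every antitone
  sequence of dyadic polygons `G k`, `K` is `P D`-a.s. weakly continuous along
  `γ.stopAt (G k) → γ.stopAt (⋂ G k)`.
* Proof (`slitHandOffApprox_of_dyadic`, for ANY law `P` a.s. carried by curves in a compact `W`
  and ANY family of laws `Q` along pasts): for closed `F` take the dyadic outer approximations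
  `G' k ↓ F ∩ W` (`stub_slitHandOff_dyadicApprox`) and `G k := G' k ∪ F ↓ F`; a curve inside
  `W` does not distinguish `G k` from `G' k` nor `F` from `F ∩ W`
  (`stopAt_startFrom_congr_of_range`), so the identities at `G' k ∈ 𝒟` and the a.s. convergence
  towards `F ∩ W` ARE the required ones at `G k` and `F`, up to `P`-null sets.  For a pinned
  family, `W = closure D` (landed chordality of pinned laws, `isProbabilityMeasure_and_ae_chordal_of_pinned`).

What remains (`H_𝒟`), and why the left-continuity clause is kept.  Given the identification on
`𝒟`, Lévy's upward theorem along the increasing σ-algebras `σ(stopAt (G k)) ↑ σ(stopAt F)`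
(`G k ↓ F`; `stopAt (G k) = stopAt (G k) ∘ stopAt F`) together with Hunt's lemma for the moving
integrands `g (startFrom (G k)) → g (startFrom F)` shows that `∫ g dK(γ.stopAt (G k))` converges
`P D`-a.s. FOR EACH announcing sequence, to `E[g (startFrom F) | stopAt F]`; so, given the
identification on `𝒟`, left-continuity along `G k ↓ F` is EQUIVALENT to the disintegration
identity at `F` through the same `K`, and `H`, `H_𝒟` and "one configuration-indexed kernel
disintegrates every `P D` at every closed `F`" are all equivalent.  What the martingale argument
does NOT give is a version of `K` good for all (uncountably many, mutually singular) stopping sets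
at once: that is a path-regularity statement for the slit law `(U, x) ↦ K (U; x, b)` (the
analogue of Feller continuity / Knight's prediction process; for the conformally invariant limit
it is Carathéodory continuity of SLE₆ laws in the slit domain), conjecture-grade for `ℤ²`
sublimits exactly like the identification itself (Garban–Pete–Schramm 2013 p. 16; Smirnov ICM
2006 §4.2).  Hence `H_𝒟` keeps the minimal form of it: a.s. left-continuity along shrinking
DYADIC polygonal stopping sets only.

References: W. Werner, Lectures on two-dimensional critical percolation (2007) §3.2 (2);
C. Garban, G. Pete, O. Schramm, J. Amer. Math. Soc. 26 (2013), p. 16; S. Smirnov, ICM 2006 §4.2;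
F. B. Knight, Ann. Probab. 3 (1975) 573–596.
-/

noncomputable section

open MeasureTheory ProbabilityTheory Filter Set Topology
open scoped BoundedContinuousFunction unitInterval ENNReal
open Literature.Probability.Percolation Literature.Probability.LatticeModels
open Literature.Probability.RandomPlanarGeometry Literature.Probability.Percolation.QuadCrossing
open Summit.CriticalPhenomena.CardyFormulaZ2.Theses.CardySelfRefinement

namespace Summit.CriticalPhenomena.CardyFormulaZ2.Cruxes.LagHandOff.HittingTournament

open Summit.CriticalPhenomena.CardyFormulaZ2.Cruxes.LagHandOff.CrosscutDictionary

section Core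

/-- **Approximating stopping sets from the dyadic class, for one law.**  Let `P` be a law on
planar curve classes a.s. carried by curves inside a compact set `W`, and `Q` any family of laws
indexed by pasts.  If `Q` disintegrates `P` at the first hitting of every dyadic polygon and is
`P`-a.s. weakly continuous along `γ.stopAt (G k) → γ.stopAt (⋂ G k)` for every antitone sequence
of dyadic polygons, then for EVERY closed `F` there are closed `G k ↓ F` (namely
`G k = (level-k dyadic outer approximation of F ∩ W) ∪ F`) at which `Q` disintegrates `P` and along which `Q` is
`P`-a.s. weakly left-continuous towards `γ.stopAt F`: curves inside `W` do not distinguish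
`G k` from the level-`k` dyadic outer approximation of `F ∩ W`, nor `F` from `F ∩ W`. [folklore] -/
theorem slitHandOffApprox_of_dyadic (P : Measure (CurveClass ℂ))
    (Q : CurveClass ℂ → Measure (CurveClass ℂ)) {W : Set ℂ} (hW : IsCompact W)
    (hae : ∀ᵐ γ ∂P, γ.range ⊆ W)
    (hmk : ∀ G : Set ℂ, (∃ (n : ℕ) (s : Finset (ℤ × ℤ)), G = ⋃ p ∈ s,
        {z : ℂ | z.re ∈ Set.Icc ((p.1 : ℝ) / 2 ^ n) (((p.1 : ℝ) + 1) / 2 ^ n) ∧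
          z.im ∈ Set.Icc ((p.2 : ℝ) / 2 ^ n) (((p.2 : ℝ) + 1) / 2 ^ n)}) →
      ∀ S T : Set (CurveClass ℂ), MeasurableSet S → MeasurableSet T →
        P (CurveClass.stopAt G ⁻¹' S ∩ CurveClass.startFrom G ⁻¹' T) =
          ∫⁻ γ in CurveClass.stopAt G ⁻¹' S, Q (γ.stopAt G) T ∂P)
    (hreg : ∀ G : ℕ → Set ℂ, (∀ k, ∃ (n : ℕ) (s : Finset (ℤ × ℤ)), G k = ⋃ p ∈ s,
        {z : ℂ | z.re ∈ Set.Icc ((p.1 : ℝ) / 2 ^ n) (((p.1 : ℝ) + 1) / 2 ^ n) ∧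
          z.im ∈ Set.Icc ((p.2 : ℝ) / 2 ^ n) (((p.2 : ℝ) + 1) / 2 ^ n)}) →
      Antitone G → ∀ g : CurveClass ℂ →ᵇ ℝ, ∀ᵐ γ ∂P,
        Tendsto (fun k => ∫ x, g x ∂(Q (γ.stopAt (G k)))) atTop
          (𝓝 (∫ x, g x ∂(Q (γ.stopAt (⋂ k, G k))))))
    {F : Set ℂ} (hF : IsClosed F) :
    ∃ G : ℕ → Set ℂ, (∀ k, IsClosed (G k)) ∧ Antitone G ∧ (⋂ k, G k) = F ∧
      (∀ k, ∀ S T : Set (CurveClass ℂ), MeasurableSet S → MeasurableSet T →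
        P (CurveClass.stopAt (G k) ⁻¹' S ∩ CurveClass.startFrom (G k) ⁻¹' T) =
          ∫⁻ γ in CurveClass.stopAt (G k) ⁻¹' S, Q (γ.stopAt (G k)) T ∂P) ∧
      ∀ g : CurveClass ℂ →ᵇ ℝ, ∀ᵐ γ ∂P,
        Tendsto (fun k => ∫ x, g x ∂(Q (γ.stopAt (G k)))) atTop
          (𝓝 (∫ x, g x ∂(Q (γ.stopAt F)))) := by
  -- dyadic outer approximations of the compact set `F ∩ W`
  have hC : IsCompact (F ∩ W) := hW.inter_left hF
  obtain ⟨G', hG'poly, hG'closed, hG'anti, hG'iInter, hCG'⟩ := stub_slitHandOff_dyadicApprox _ hC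
  -- curves inside `W` do not distinguish `G' k ∪ F` from `G' k`, nor `F` from `F ∩ W`
  have hpt : ∀ k, ∀ γ : CurveClass ℂ, γ.range ⊆ W →
      γ.stopAt (G' k ∪ F) = γ.stopAt (G' k) ∧ γ.startFrom (G' k ∪ F) = γ.startFrom (G' k) :=
    fun k γ hγ => stopAt_startFrom_congr_of_range fun z hz =>
      ⟨fun h => h.elim id fun hzF => hCG' k ⟨hzF, hγ hz⟩, fun h => Or.inl h⟩
  have hptF : ∀ γ : CurveClass ℂ, γ.range ⊆ W → γ.stopAt F = γ.stopAt (F ∩ W) :=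
    fun γ hγ => (stopAt_startFrom_congr_of_range (A := F) (B := F ∩ W) (c := γ) fun z hz =>
      ⟨fun h => ⟨h, hγ hz⟩, fun h => h.1⟩).1
  refine ⟨fun k => G' k ∪ F, fun k => (hG'closed k).union hF,
    fun k l hkl => union_subset_union_left F (hG'anti hkl), ?_, fun k S T hS hT => ?_,
    fun g => ?_⟩
  · -- `⋂ (G' k ∪ F) = (F ∩ W) ∪ F = F`
    refine Subset.antisymm (fun z hz => ?_) fun z hz => mem_iInter.2 fun k => Or.inr hz
    rw [mem_iInter] at hz
    by_contra hzF
    have h : z ∈ ⋂ k, G' k := mem_iInter.2 fun k => (hz k).resolve_right hzF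
    rw [hG'iInter] at h
    exact hzF h.1
  · -- the disintegration identity at the dyadic polygon `G' k` is the one at `G' k ∪ F`
    have h1 : (CurveClass.stopAt (G' k ∪ F) ⁻¹' S ∩ CurveClass.startFrom (G' k ∪ F) ⁻¹' T :
        Set (CurveClass ℂ)) =ᵐ[P]
        (CurveClass.stopAt (G' k) ⁻¹' S ∩ CurveClass.startFrom (G' k) ⁻¹' T : Set (CurveClass ℂ)) :=
      Filter.eventuallyEq_set.2 (hae.mono fun γ hγ => by
        simp only [mem_inter_iff, mem_preimage, (hpt k γ hγ).1, (hpt k γ hγ).2])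
    have h2 : (CurveClass.stopAt (G' k) ⁻¹' S : Set (CurveClass ℂ)) =ᵐ[P]
        (CurveClass.stopAt (G' k ∪ F) ⁻¹' S : Set (CurveClass ℂ)) :=
      Filter.eventuallyEq_set.2 (hae.mono fun γ hγ => by
        rw [mem_preimage, mem_preimage, (hpt k γ hγ).1])
    change P (CurveClass.stopAt (G' k ∪ F) ⁻¹' S ∩ CurveClass.startFrom (G' k ∪ F) ⁻¹' T) =
      ∫⁻ γ in CurveClass.stopAt (G' k ∪ F) ⁻¹' S, Q (γ.stopAt (G' k ∪ F)) T ∂P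
    rw [measure_congr h1, hmk (G' k) (hG'poly k) S T hS hT, setLIntegral_congr h2]
    exact lintegral_congr_ae (ae_restrict_of_ae (hae.mono fun γ hγ => by
      simp only [(hpt k γ hγ).1]))
  · -- a.s. convergence towards `F ∩ W = ⋂ G' k` is convergence towards `F`
    have h := hreg G' hG'poly hG'anti g
    simp only [hG'iInter] at h
    filter_upwards [h, hae] with γ hγ hγW
    have h1 : ∀ k, γ.stopAt (G' k ∪ F) = γ.stopAt (G' k) := fun k => (hpt k γ hγW).1
    simp only [h1, hptF γ hγW]
    exact hγ

end Core

section Reduction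

/-- **Registered reduction `stub_slitHandOff_of_dyadic` of `stub_slitHandOff` (R2″)**: the slit
hand-off on approximating stopping sets (hypothesis `H` of `stub_limitMarkov_of_core`) follows
from its DYADIC form `H_𝒟` — for every chordal family `P` pinned by a subsequential
quad-crossing limit (and discretisability of every Dobrushin domain) ONE slit kernel `K (U; x, b)`
(probability laws, Borel along pasts) which (i) disintegrates every `P D` at the first hitting of
every DYADIC POLYGON (finite union of closed dyadic squares of one level) through
`K (remainingDomain D ·; tip, b)` — the slit identification on a countable class of stopping sets
with axis-parallel sides — and (ii) is `P D`-a.s. weakly continuous along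
`γ.stopAt (G k) → γ.stopAt (⋂ G k)` for every antitone sequence of dyadic polygons `G k` — the
path regularity of the slit law without which no single kernel serves uncountably many stopping
sets.  The approximating sets for a closed `F` are the dyadic outer approximations of `F ∩ closure D` united with `F`; pinned
laws live on curves in `closure D` (`isProbabilityMeasure_and_ae_chordal_of_pinned`), which do
not distinguish them from dyadic polygons (`slitHandOffApprox_of_dyadic`).  Both clauses of `H_𝒟`
are conjecture-grade for `ℤ²` sublimits (GPS13 p. 16; Smirnov ICM 2006 §4.2). [folklore] -/
theorem stub_slitHandOff_of_dyadic : (∀ μ ∈ subseqQuadLimits (Set.univ : Set ℂ), ∀ P : ChordalFamily, (∀ δs : ℕ → ℝ, (∀ n, 0 < δs n) → Tendsto δs atTop (𝓝 0) → Tendsto (fun n => z2QuadLaw (Set.univ : Set ℂ) (δs n)) atTop (𝓝 μ) → ∀ (D : DobrushinDomain) (E : ℝ → DiscreteDobrushin), ZdDiscretisationFamily D E → ∀ f : CurveClass ℂ →ᵇ ℝ, Tendsto (fun n => ∫ ω, f (bondInterfaceIn D (E (δs n)) ω) ∂(bondPercolation (zdGraph 2) half)) atTop (𝓝 (∫ γ,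 f γ ∂(P D)))) → (∀ D : DobrushinDomain, ∃ E : ℝ → DiscreteDobrushin, ZdDiscretisationFamily D E) → ∃ K : Set ℂ → ℂ → ℂ → Measure (CurveClass ℂ), (∀ U x b, IsProbabilityMeasure (K U x b)) ∧ (∀ (D : DobrushinDomain) (T : Set (CurveClass ℂ)), MeasurableSet T → Measurable fun p : CurveClass ℂ => K (remainingDomain D p) p.target (D.pt 1) T) ∧ (∀ (D : DobrushinDomain) (G : Set ℂ), (∃ (n : ℕ) (s : Finset (ℤ × ℤ)), G = ⋃ p ∈ s, {z : ℂ | z.re ∈ Set.Icc ((p.1 : ℝ) / 2 ^ n) (((p.1 : ℝ) + 1) / 2 ^ n) ∧ z.im ∈ Set.Icc ((p.2 : ℝ) / 2 ^ n) (((p.2 : ℝ) + 1) / 2 ^ n)}) → ∀ S T : Set (CurveClass ℂ), MeasurableSet S → MeasurableSet T → P D (CurveClass.stopAt G ⁻¹' S ∩ CurveClass.startFrom G ⁻¹' T) = ∫⁻ γ in CurveClass.stopAt G ⁻¹' S, K (remainingDomain D (γ.stopAt G)) (γ.stopAt G).target (D.pt 1) T ∂(P D)) ∧ ∀ (D : DobrushinDomain)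 (G : ℕ → Set ℂ), (∀ k, ∃ (n : ℕ) (s : Finset (ℤ × ℤ)), G k = ⋃ p ∈ s, {z : ℂ | z.re ∈ Set.Icc ((p.1 : ℝ) / 2 ^ n) (((p.1 : ℝ) + 1) / 2 ^ n) ∧ z.im ∈ Set.Icc ((p.2 : ℝ) / 2 ^ n) (((p.2 : ℝ) + 1) / 2 ^ n)}) → Antitone G → ∀ g : CurveClass ℂ →ᵇ ℝ, ∀ᵐ γ ∂(P D), Tendsto (fun k => ∫ x, g x ∂(K (remainingDomain D (γ.stopAt (G k))) (γ.stopAt (G k)).target (D.pt 1))) atTop (𝓝 (∫ x, g x ∂(K (remainingDomain D (γ.stopAt (⋂ k, G k))) (γ.stopAt (⋂ k, G k)).target (D.pt 1))))) → ∀ μ ∈ subseqQuadLimits (Set.univ : Set ℂ), ∀ P : ChordalFamily, (∀ δs : ℕ → ℝ, (∀ n, 0 < δs n) → Tendsto δs atTop (𝓝 0) → Tendsto (fun n => z2QuadLaw (Set.univ : Set ℂ) (δs n)) atTop (𝓝 μ) → ∀ (D : DobrushinDomain) (E : ℝ → DiscreteDobrushin), ZdDiscretisationFamily D E → ∀ f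 : CurveClass ℂ →ᵇ ℝ, Tendsto (fun n => ∫ ω, f (bondInterfaceIn D (E (δs n)) ω) ∂(bondPercolation (zdGraph 2) half)) atTop (𝓝 (∫ γ, f γ ∂(P D)))) → (∀ D : DobrushinDomain, ∃ E : ℝ → DiscreteDobrushin, ZdDiscretisationFamily D E) → ∃ K : Set ℂ → ℂ → ℂ → Measure (CurveClass ℂ), (∀ U x b, IsProbabilityMeasure (K U x b)) ∧ (∀ (D : DobrushinDomain) (T : Set (CurveClass ℂ)), MeasurableSet T → Measurable fun p : CurveClass ℂ => K (remainingDomain D p) p.target (D.pt 1) T) ∧ ∀ (D : DobrushinDomain) (F : Set ℂ), IsClosed F → ∃ G : ℕ → Set ℂ, (∀ k, IsClosed (G k)) ∧ Antitone G ∧ (⋂ k, G k) = F ∧ (∀ k, ∀ S T : Set (CurveClass ℂ), MeasurableSet S → MeasurableSet T → P D (CurveClass.stopAt (G k) ⁻¹' S ∩ CurveClass.startFrom (G k) ⁻¹' T) = ∫⁻ γ in CurveClass.stopAt (G k) ⁻¹' S, K (remainingDomain D (γ.stopAt (G k))) (γ.stopAt (G k)).target (D.pt 1) T ∂(P D)) ∧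 ∀ g : CurveClass ℂ →ᵇ ℝ, ∀ᵐ γ ∂(P D), Tendsto (fun k => ∫ x, g x ∂(K (remainingDomain D (γ.stopAt (G k))) (γ.stopAt (G k)).target (D.pt 1))) atTop (𝓝 (∫ x, g x ∂(K (remainingDomain D (γ.stopAt F)) (γ.stopAt F).target (D.pt 1)))) := by
  intro hD μ hμ P hpin hdisc
  obtain ⟨K, hKprob, hKm, hmk, hreg⟩ := hD μ hμ P hpin hdisc
  refine ⟨K, hKprob, hKm, fun D F hF => ?_⟩
  have hae : ∀ᵐ γ ∂(P D), γ.range ⊆ closure D.carrier :=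
    ((isProbabilityMeasure_and_ae_chordal_of_pinned hμ hpin (hdisc D)).2).mono
      fun γ hγ => hγ.2.2
  exact slitHandOffApprox_of_dyadic (P D)
    (fun p => K (remainingDomain D p) p.target (D.pt 1)) D.isBounded.isCompact_closure hae
    (fun G hG => hmk D G hG) (fun G hG hanti => hreg D G hG hanti) hF

end Reduction

end Summit.CriticalPhenomena.CardyFormulaZ2.Cruxes.LagHandOff.HittingTournament

end
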